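import Mathlib.MeasureTheory.Integral.ExpDecay
import Mathlib.Analysis.SpecialFunctions.ImproperIntegrals
import Literature.Analysis.FunctionSpaces.BesselJProofs
import Literature.Analysis.FunctionSpaces.BesselJWeberSchafheitlin
import Literature.Analysis.FunctionSpaces.LiebWuIntegrals
import HarnessLib

/-!
# Discharged facts: integrability of the Lieb–Wu integrands and the free-fermion limit

`Literature.Analysis.FunctionSpaces.LiebWuIntegrals` records as named facts
(`Literature.Analysis.FunctionSpaces.integrableOn_liebWuEnergy_integrand`,
`Literature.Hubbard.integrableOn_liebWuChargeGap_integrand : Prop`) that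

* for `U > 0` the integrand `ω ↦ J₀(ω) J₁(ω) / (ω (1 + e^{ωU/2}))` of the Lieb–Wu ground-state
  energy of the half-filled Hubbard chain,
  `E₀(N_a/2, N_a/2) = -4 N_a ∫₀^∞ J₀(ω) J₁(ω) / (ω (1 + e^{ωU/2})) dω`
  (Lieb–Wu, *The one-dimensional Hubbard model: a reminiscence*, Physica A 321 (2003) 1–27 =
  arXiv:cond-mat/0207529, §6 "Solution for the half-filled band", boxed formula for
  `E₀(N_a/2, N_a/2)` on p. 13 of the arXiv version; originally Lieb–Wu, PRL 20 (1968) 1445,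
  eq. (20)), and
* for `U ≥ 0` the integrand `ω ↦ J₁(ω) / (ω (1 + e^{ωU/2}))` of the chemical potential at half
  filling, `μ₋(U) = 2 - 4 ∫₀^∞ J₁(ω) / (ω [1 + exp(ωU/2)]) dω`, whence the charge gap
  `μ₊ - μ₋ = U - 2 μ₋(U)` (loc. cit., §7 "Absence of a Mott transition", boxed formula for `μ₋(U)`
  and its `U = 0` case `μ₋(0) = 2 - 2 ∫₀^∞ J₁(ω)/ω dω = 0`, p. 15 of the arXiv version; PRL 20
  (1968) 1445, eq. (22)),

are integrable on `(0, ∞)`. The paper uses the convergence of these integrals tacitly; this file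
proves it (`Literature.Analysis.FunctionSpaces.integrableOn_liebWuEnergy_integrand_holds`,
`Literature.Analysis.FunctionSpaces.integrableOn_liebWuChargeGap_integrand_holds`).

## Proofs

From `Literature.Analysis.FunctionSpaces.BesselJProofs`: `|J₀(ω)| ≤ 1` (DLMF 10.14.1),
`|J₁(ω)| ≤ ω/2` for `ω ≥ 0` (DLMF 10.14.4), `|J₁(ω)| ≤ C ω^{-1/2}` for `ω ≥ 2`
(`Literature.Analysis.FunctionSpaces.abs_besselJ_le_mul_rpow_neg_half`, the leading order of DLMF 10.17.3), and `J₀, J₁` are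
continuous. Hence on `(0, ∞)` both integrands are continuous, and

* energy: `|J₀(ω) J₁(ω) / (ω (1 + e^{ωU/2}))| ≤ (ω/2) / (ω (1 + e^{ωU/2})) ≤ e^{-(U/2) ω} / 2`,
  which is integrable on `(0, ∞)` for `U > 0` (`exp_neg_integrableOn_Ioi`);
* charge gap: `|J₁(ω) / (ω (1 + e^{ωU/2}))| ≤ 1/2` on `(0, 2]` and `≤ |J₁(ω)|/ω ≤ C ω^{-3/2}` on
  `(2, ∞)` (`integrableOn_Ioi_rpow_of_lt`), for every real `U`;

conclude with `Integrable.mono'` (and `IntegrableOn.union` over `(0, ∞) = (0, 2] ∪ (2, ∞)`).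

## The free-fermion limit `e(U) → -4/π` (`Literature.Analysis.FunctionSpaces.tendsto_liebWuEnergy_zero_holds`)

This file also discharges `Literature.Analysis.FunctionSpaces.tendsto_liebWuEnergy_zero`:
`e(U) = -4 ∫₀^∞ J₀J₁/(ω(1 + e^{ωU/2})) dω → -4/π` as `U → 0⁺`, i.e. the closed form is continuous
at `U = 0⁺` with the free-fermion value: at `U = 0` the momentum density is `ρ₀(k) = 1/π` on
`|k| ≤ π/2` (Lieb–Wu 2003, §6, Remark (A): "agrees with what is expected for an ideal Fermi gas"),
so `E₀/N_a = -2 ∫ ρ₀(k) cos k dk = -4/π`; the 1968 Letter notes (after eq. (23)) that the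
ground-state energy is analytic in `U` on the real axis except at the origin. The papers take the
Bessel-function identity for granted; the proof here is: dominated convergence on `(0, ∞)` as
`U → 0⁺` (the integrands are dominated uniformly in `U` by `|J₀(ω)J₁(ω)/ω|`, integrable by the decay
`J₁(ω)/ω = O(ω^{-3/2})`, and converge pointwise to `J₀J₁/(2ω)`), and the Weber–Schafheitlin value
`∫₀^∞ J₀(ω)J₁(ω)/ω dω = 2/π` (`Literature.Analysis.FunctionSpaces.BesselJWeberSchafheitlin`, proved
there via Poisson's integrals, the Fourier transform `π J₁(y)/y` of the semicircle `√(1-x²)₊` — the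
transform Lieb–Wu use in §7.1 — and Mathlib's Fourier inversion theorem). Hence the limit is
`-4 · (1/2) · (2/π) = -4/π`.

## References

* E. H. Lieb, F. Y. Wu, *The one-dimensional Hubbard model: a reminiscence*, Physica A 321 (2003)
  1–27, arXiv:cond-mat/0207529, §6, p. 13 (formula for `E₀(N_a/2, N_a/2)`); §7, p. 15 (formula
  for `μ₋(U)`, and `μ₋(0) = 0`).
* E. H. Lieb, F. Y. Wu, Phys. Rev. Lett. 20 (1968) 1445, eqs. (20), (22).
* NIST DLMF 10.14.1, 10.14.4, 10.17.3.
* G. E. Andrews, R. Askey, R. Roy, *Special Functions* (Cambridge, 1999), Exercise 4.15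
  (Weber–Schafheitlin integral), §4.9 (4.9.12) (Poisson's integrals); Lieb–Wu 2003, §6 Remark (A)
  (`U = 0` densities), §7.1 (Fourier transform of `√(1-x²)`).
-/

noncomputable section

open scoped Topology
open Filter Set MeasureTheory

namespace Literature.Analysis.FunctionSpaces

section Hubbard

/-- The Lieb–Wu energy integrand `J₀ J₁ / (ω (1 + e^{ωU/2}))` is continuous on `(0, ∞)`
(the denominator is positive there). [folklore] -/
theorem continuousOn_liebWuEnergyIntegrand (U : ℝ) :
    ContinuousOn (liebWuEnergyIntegrand U) (Ioi 0) := by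
  have hc : Continuous fun ω : ℝ => ω * (1 + Real.exp (ω * U / 2)) := by fun_prop
  refine (((continuous_besselJ_holds 0).mul (continuous_besselJ_holds 1)).continuousOn).div
    hc.continuousOn fun ω hω => ?_
  have hω : (0 : ℝ) < ω := hω
  positivity

/-- Pointwise domination on `(0, ∞)`: `|J₀(ω) J₁(ω) / (ω (1 + e^{ωU/2}))| ≤ e^{-(U/2) ω} / 2`,
from `|J₀| ≤ 1` (DLMF 10.14.1), `|J₁(ω)| ≤ ω/2` (DLMF 10.14.4) and
`1 / (1 + e^{a}) ≤ e^{-a}`. [folklore] -/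
theorem abs_liebWuEnergyIntegrand_le {U ω : ℝ} (hω : 0 < ω) :
    |liebWuEnergyIntegrand U ω| ≤ Real.exp (-(U / 2) * ω) / 2 := by
  have hJ0 := abs_besselJ_zero_le_one_holds ω
  have hJ1 := abs_besselJ_one_le_half_mul hω.le
  have hden : 0 < ω * (1 + Real.exp (ω * U / 2)) := by positivity
  have hexp : Real.exp (-(U / 2) * ω) * Real.exp (ω * U / 2) = 1 := by
    rw [← Real.exp_add]
    convert Real.exp_zero using 2
    ring
  rw [liebWuEnergyIntegrand, abs_div, abs_mul, abs_of_pos hden, div_le_iff₀ hden]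
  calc |besselJ 0 ω| * |besselJ 1 ω| ≤ 1 * (ω / 2) :=
        mul_le_mul hJ0 hJ1 (abs_nonneg _) zero_le_one
    _ = ω / 2 := one_mul _
    _ ≤ ω / 2 + ω / 2 * Real.exp (-(U / 2) * ω) := le_add_of_nonneg_right (by positivity)
    _ = Real.exp (-(U / 2) * ω) / 2 * (ω * (1 + Real.exp (ω * U / 2))) := by
        linear_combination (-(ω / 2)) * hexp

/-- **Discharge of `Literature.Analysis.FunctionSpaces.integrableOn_liebWuEnergy_integrand`**: for `U > 0` the Lieb–Wu
energy integrand `J₀(ω) J₁(ω) / (ω (1 + e^{ωU/2}))` is integrable on `(0, ∞)` — it is continuous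
there and dominated by `e^{-(U/2) ω} / 2`. This is the (tacit) convergence of the integral in the
Lieb–Wu ground-state energy formula `E₀(N_a/2,N_a/2) = -4 N_a ∫₀^∞ J₀ J₁ / (ω (1 + e^{ωU/2})) dω`
(Lieb–Wu, Physica A 321 (2003) 1, §6, boxed formula p. 13 of arXiv:cond-mat/0207529; PRL 20 (1968)
1445, eq. (20)). [cite: LiebWuPhysicaA2003, §6, formula for E₀(N_a/2, N_a/2)] -/
theorem integrableOn_liebWuEnergy_integrand_holds : integrableOn_liebWuEnergy_integrand := by
  intro U hU
  have hdom : IntegrableOn (fun ω => Real.exp (-(U / 2) * ω) / 2) (Ioi 0) :=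
    (exp_neg_integrableOn_Ioi 0 (by positivity)).div_const 2
  refine Integrable.mono' hdom
    ((continuousOn_liebWuEnergyIntegrand U).aestronglyMeasurable measurableSet_Ioi) ?_
  refine ae_restrict_of_forall_mem measurableSet_Ioi fun ω hω => ?_
  rw [Real.norm_eq_abs]
  exact abs_liebWuEnergyIntegrand_le hω

/-! ## The charge-gap integrand `J₁ / (ω (1 + e^{ωU/2}))` -/

/-- The Lieb–Wu charge-gap integrand `J₁ / (ω (1 + e^{ωU/2}))` is continuous on `(0, ∞)`
(the denominator is positive there). [folklore] -/
theorem continuousOn_liebWuChargeGapIntegrand (U : ℝ) :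
    ContinuousOn (liebWuChargeGapIntegrand U) (Ioi 0) := by
  have hc : Continuous fun ω : ℝ => ω * (1 + Real.exp (ω * U / 2)) := by fun_prop
  refine ((continuous_besselJ_holds 1).continuousOn).div hc.continuousOn fun ω hω => ?_
  have hω : (0 : ℝ) < ω := hω
  positivity

/-- Bound near `0`: `|J₁(ω) / (ω (1 + e^{ωU/2}))| ≤ 1/2` for `ω > 0` and every real `U`, from
`|J₁(ω)| ≤ ω/2` (DLMF 10.14.4) and `1 + e^{ωU/2} > 1`. [folklore] -/
theorem abs_liebWuChargeGapIntegrand_le_half {U ω : ℝ} (hω : 0 < ω) :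
    |liebWuChargeGapIntegrand U ω| ≤ 1 / 2 := by
  have hJ1 := abs_besselJ_one_le_half_mul hω.le
  have he : 0 < Real.exp (ω * U / 2) := Real.exp_pos _
  have hden : 0 < ω * (1 + Real.exp (ω * U / 2)) := by positivity
  rw [liebWuChargeGapIntegrand, abs_div, abs_of_pos hden, div_le_iff₀ hden]
  nlinarith [mul_pos hω he]

/-- Bound at infinity: `|J₁(ω) / (ω (1 + e^{ωU/2}))| ≤ |J₁(ω)| / ω` for `ω > 0` and every real `U`
(`0 < (1 + e^{ωU/2})⁻¹ < 1`). [folklore] -/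
theorem abs_liebWuChargeGapIntegrand_le_div {U ω : ℝ} (hω : 0 < ω) :
    |liebWuChargeGapIntegrand U ω| ≤ |besselJ 1 ω| / ω := by
  have he : 0 < Real.exp (ω * U / 2) := Real.exp_pos _
  have hden : 0 < ω * (1 + Real.exp (ω * U / 2)) := by positivity
  rw [liebWuChargeGapIntegrand, abs_div, abs_of_pos hden]
  exact div_le_div_of_nonneg_left (abs_nonneg _) hω (by nlinarith [mul_pos hω he])

/-- **Discharge of `Literature.Analysis.FunctionSpaces.integrableOn_liebWuChargeGap_integrand`**: for `U ≥ 0` (indeed for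
every real `U`) the Lieb–Wu charge-gap integrand `J₁(ω) / (ω (1 + e^{ωU/2}))` is integrable on
`(0, ∞)`: it is continuous there, bounded by `1/2` on `(0, 2]` (`|J₁(ω)| ≤ ω/2`, DLMF 10.14.4) and
by `C ω^{-3/2}` on `(2, ∞)` (`|J₁(ω)| ≤ C ω^{-1/2}` for `ω ≥ 2`,
`Literature.Analysis.FunctionSpaces.abs_besselJ_le_mul_rpow_neg_half`, the leading order of DLMF 10.17.3). This is the (tacit)
convergence of the integral in the Lieb–Wu formula for the chemical potential at half filling,
`μ₋(U) = 2 - 4 ∫₀^∞ J₁(ω) / (ω [1 + exp(ωU/2)]) dω` (Lieb–Wu, Physica A 321 (2003) 1, §7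
"Absence of a Mott transition", boxed formula (for `μ₋(U)`) on p. 15 of arXiv:cond-mat/0207529, and
its `U = 0` case `μ₋(0) = 2 - 2 ∫₀^∞ J₁(ω)/ω dω = 0` there; PRL 20 (1968) 1445, eq. (22)), which
enters the charge gap `μ₊ - μ₋ = U - 2 μ₋`. [cite: LiebWuPhysicaA2003, §7, formula for μ₋(U)] -/
theorem integrableOn_liebWuChargeGap_integrand_holds : integrableOn_liebWuChargeGap_integrand := by
  intro U _
  obtain ⟨C, hC⟩ := abs_besselJ_le_mul_rpow_neg_half 1
  have hmeas : AEStronglyMeasurable (liebWuChargeGapIntegrand U) (volume.restrict (Ioi 0)) :=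
    (continuousOn_liebWuChargeGapIntegrand U).aestronglyMeasurable measurableSet_Ioi
  rw [← Ioc_union_Ioi_eq_Ioi (zero_le_two (α := ℝ))]
  refine IntegrableOn.union ?_ ?_
  · refine Integrable.mono'
      (integrableOn_const (C := (1 / 2 : ℝ)) (measure_Ioc_lt_top (a := (0 : ℝ)) (b := 2)).ne)
      (hmeas.mono_measure (Measure.restrict_mono Ioc_subset_Ioi_self le_rfl)) ?_
    refine ae_restrict_of_forall_mem measurableSet_Ioc fun ω hω => ?_
    rw [Real.norm_eq_abs]
    exact abs_liebWuChargeGapIntegrand_le_half hω.1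
  · have hdom : IntegrableOn (fun ω : ℝ => C * ω ^ (-(3 / 2 : ℝ))) (Ioi 2) :=
      (integrableOn_Ioi_rpow_of_lt (by norm_num) zero_lt_two).const_mul C
    refine Integrable.mono' hdom
      (hmeas.mono_measure (Measure.restrict_mono (Ioi_subset_Ioi zero_le_two) le_rfl)) ?_
    refine ae_restrict_of_forall_mem measurableSet_Ioi fun ω hω => ?_
    have hω2 : (2 : ℝ) < ω := hω
    have hω0 : 0 < ω := by linarith
    rw [Real.norm_eq_abs]
    calc |liebWuChargeGapIntegrand U ω|
        ≤ |besselJ 1 ω| / ω := abs_liebWuChargeGapIntegrand_le_div hω0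
      _ ≤ C * ω ^ (-(1 / 2 : ℝ)) / ω := by
          gcongr
          exact hC ω (by norm_num; linarith)
      _ = C * ω ^ (-(3 / 2 : ℝ)) := by
          rw [mul_div_assoc, div_eq_mul_inv, ← Real.rpow_neg_one ω, ← Real.rpow_add hω0]
          norm_num

/-- Uniform domination of the Lieb–Wu energy integrand: for every real `U` and `ω > 0`,
`|J₀(ω) J₁(ω) / (ω (1 + e^{ωU/2}))| ≤ |J₀(ω) J₁(ω) / ω|` (the Fermi-type factor is at most `1`). [folklore] -/
theorem abs_liebWuEnergyIntegrand_le_abs (U : ℝ) {ω : ℝ} (hω : 0 < ω) :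
    |liebWuEnergyIntegrand U ω| ≤ |besselJ 0 ω * besselJ 1 ω / ω| := by
  have hpos : 0 < 1 + Real.exp (ω * U / 2) := by positivity
  rw [liebWuEnergyIntegrand, abs_div, abs_div, abs_mul ω, abs_of_pos hω, abs_of_pos hpos]
  refine div_le_div_of_nonneg_left (abs_nonneg _) hω ?_
  have h1 : 1 ≤ 1 + Real.exp (ω * U / 2) := by linarith [Real.exp_pos (ω * U / 2)]
  nlinarith

/-- Pointwise limit of the Lieb–Wu energy integrand: for `ω > 0`,
`J₀(ω) J₁(ω) / (ω (1 + e^{ωU/2})) → J₀(ω) J₁(ω) / (2ω)` as `U → 0`. [folklore] -/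
theorem tendsto_liebWuEnergyIntegrand {ω : ℝ} (hω : 0 < ω) :
    Tendsto (fun U : ℝ => liebWuEnergyIntegrand U ω) (𝓝 0)
      (𝓝 (besselJ 0 ω * besselJ 1 ω / (2 * ω))) := by
  have hd : Continuous fun U : ℝ => ω * (1 + Real.exp (ω * U / 2)) := by fun_prop
  have hd0 : Tendsto (fun U : ℝ => ω * (1 + Real.exp (ω * U / 2))) (𝓝 0) (𝓝 (2 * ω)) := by
    have h := hd.tendsto 0
    simp only [mul_zero, zero_div, Real.exp_zero] at h
    convert h using 2
    ring
  have h := (tendsto_const_nhds (x := besselJ 0 ω * besselJ 1 ω)).div hd0 (by positivity)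
  exact h

/-- **Discharge of `Literature.Analysis.FunctionSpaces.tendsto_liebWuEnergy_zero`** (free-fermion limit of the Lieb–Wu
energy): `e(U) = -4 ∫₀^∞ J₀J₁/(ω(1 + e^{ωU/2})) dω → -4/π` as `U → 0⁺`. Proof: dominated convergence on
`(0, ∞)` (the integrands are dominated, uniformly in `U`, by the integrable `|J₀(ω)J₁(ω)/ω|`, and
converge pointwise to `J₀J₁/(2ω)`), and the Weber–Schafheitlin value `∫₀^∞ J₀(ω)J₁(ω)/ω dω = 2/π`
(`Literature.Analysis.FunctionSpaces.integral_Ioi_besselJ_zero_mul_besselJ_one_div`), so the limit is `-4 · (1/2) · (2/π) = -4/π`,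
the ground-state energy per site of the free half-filled chain (Lieb–Wu, Physica A 321 (2003) 1, §6,
boxed formula for `E₀(N_a/2, N_a/2)` and Remark (A): `ρ₀(k) = 1/π` on `|k| ≤ π/2` at `U = 0`, whence
`E₀/N_a = -2 ∫ ρ₀ cos k = -4/π`; PRL 20 (1968) 1445, eq. (20)). [cite: LiebWuPhysicaA2003, §6, formula for E₀(N_a/2, N_a/2) and Remark (A)] -/
theorem tendsto_liebWuEnergy_zero_holds : tendsto_liebWuEnergy_zero := by
  unfold tendsto_liebWuEnergy_zero
  have hlim : Tendsto (fun U : ℝ => ∫ ω in Ioi (0 : ℝ), liebWuEnergyIntegrand U ω) (𝓝[>] 0)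
      (𝓝 (∫ ω in Ioi (0 : ℝ), besselJ 0 ω * besselJ 1 ω / (2 * ω))) := by
    refine tendsto_integral_filter_of_dominated_convergence
      (fun ω => |besselJ 0 ω * besselJ 1 ω / ω|) ?_ ?_ ?_ ?_
    · exact Eventually.of_forall fun U =>
        (continuousOn_liebWuEnergyIntegrand U).aestronglyMeasurable measurableSet_Ioi
    · refine Eventually.of_forall fun U => ?_
      refine ae_restrict_of_forall_mem measurableSet_Ioi fun ω hω => ?_
      rw [Real.norm_eq_abs]
      exact abs_liebWuEnergyIntegrand_le_abs U hω
    · exact integrableOn_besselJ_zero_mul_besselJ_one_div.abs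
    · refine ae_restrict_of_forall_mem measurableSet_Ioi fun ω hω => ?_
      exact (tendsto_liebWuEnergyIntegrand hω).mono_left nhdsWithin_le_nhds
  have hval : ∫ ω in Ioi (0 : ℝ), besselJ 0 ω * besselJ 1 ω / (2 * ω) = 1 / Real.pi := by
    have h2 : (fun ω : ℝ => besselJ 0 ω * besselJ 1 ω / (2 * ω)) =
        fun ω => (1 / 2 : ℝ) * (besselJ 0 ω * besselJ 1 ω / ω) := by
      funext ω; ring
    rw [h2, MeasureTheory.integral_const_mul, integral_Ioi_besselJ_zero_mul_besselJ_one_div]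
    field_simp
  rw [hval] at hlim
  have h4 := hlim.const_mul (-4)
  rw [show (-4 : ℝ) * (1 / Real.pi) = -4 / Real.pi by ring] at h4
  exact h4


end Hubbard

end Literature.Analysis.FunctionSpaces
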